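import Summits.BirchSwinnertonDyer.BirchSwinnertonDyer.Theorems.AdditiveKolyvaginRoadLocalFrobenius
import Summits.BirchSwinnertonDyer.BirchSwinnertonDyer.Theorems.KolyvaginRoadThreeMethod2TameSign
import HarnessLib

/-!
# Route `AdditiveKolyvaginRoad`, crux `KolyvaginPrimitiveAdditive` (item stmt-BirchSwinnertonDyer-20132):
# stub A1 `stub_rankLoweringAdditive`, input (Equiv) I — the SIGN `ε_q` of a Bertolini–Darmon admissible prime on
# `E[p]`, and the Frobenius lift of complex conjugation at the place above it
# (cell `pub/bsd-wall`, lead prover `bsd-wall-akr-p1` g2; `--supports stmt-BirchSwinnertonDyer-20132`, helper;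
# p-generic port of zhang3-p1's `Theorems/KolyvaginRoadThreeMethod2LocalEquivOfTame.lean` §2–§3, with the
# unipotent `±(1 + N')` replaced by the semisimple `diag(ε, εq)` of a BD-admissible prime)

WHY THIS FILE. Of the five inputs of akr-p1 g0's reduction of stub A1 (`selQP_rankLowering_of_localGlobal`, p511644),
(Line), (Trans), (Iso) are kernel theorems (siblings `AdditiveKolyvaginRoadLocalFrobenius`, `…Iso`). (Equiv) asks, at a
BD-admissible `q` (inert in `K`, `q ∤ pN`, `p ∤ q² − 1`, `a_q ≡ ε(q + 1) (mod p)`) and the place `v ∣ q`, for a sign `s`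
with `loc_v (c_* z) = sgn s · loc_v z` for EVERY `z ∈ H¹(K, E[p])` (W. Zhang 2014 (9.2): `τ` acts on `H¹(K_q, E[p])` by
`ε_q`). This file prepares the cocycle argument of the sibling `AdditiveKolyvaginRoadLocalEquiv`:

* §1 `exists_sign_of_isAdmissiblePrime` — for an arithmetic Frobenius `h ∈ Γ_ℚ` above `q`, on `E(ℚ̄)[p]`:
  `ρ̄(h) ∼ diag(ε, εq)` in the two forms the cocycle argument consumes — `h y − ε y ∈ (h² − 1)E[p]` for all `y`
  (`h ≡ ε` modulo the TORIC line `(h² − 1)E[p] = L_{εq}`) and `h y = εq · y` on the `q²`-eigenspace of `h²` (= `L_{εq}`).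
  Linear algebra on the `𝔽_p`-plane `E[p]` from `tr ρ̄(h) = a_q ≡ ε(q + 1)`, `det ρ̄(h) = q` (tree
  `trace_galoisRepTorsion_frobenius_eq`, `det_galoisRepTorsion_frobenius_eq`) and Cayley–Hamilton:
  `(h² − 1)(h − ε)y = (q² − 1)(h − ε)y`, and `h² y = q² y ⟹ ε(q + 1) h y = q(q + 1) y`.
* §2 `exists_lift_frob_of_isAdmissiblePrime` — at `v ∣ q` (`[K : ℚ] = 2`, `c ≠ 1`): an arithmetic Frobenius
  `h ∈ Γ_ℚ` at the prime of `\bar ℤ` below `𝔓 = 𝔓_{ι₀,𝔐}`, an arithmetic Frobenius `F ∈ Γ_K` at `𝔓` with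
  `res F = h²`, a sign `ε = ±1`, such that the transport `t = e h e⁻¹` LIFTS `c` (`h ∉ res Γ_K` as `f(v|q) = 2`),
  `t⁻¹ F t = F`, and `t` acts on `E(K̄)[p]` (`IsLiftOfAut.torsionMap`) as `ε` modulo `(F − 1)E(K̄)[p]` and as `εq` on
  the `q²`-eigenspace of `F` (§1 transported along `E(ℚ̄)[p] ≃ E(K̄)[p]`). Port of zhang3-p1's
  `exists_lift_frob_of_uAdmissible` (the `p`-generic analogue of the tree's `exists_frobeniusLift_of_isKolyvaginPrime`).

HONEST FRAMING: theorems only; no definition, no named fact, no `sorry`; (Equiv) is NOT proved here (sibling file);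
(Cheb) and the other stubs untouched; nothing is booked.

References: [cite: WZhang2014, §9 (9.2), Notations (xiv)] [cite: BertoliniDarmon2005, p. 18, §2.2 Lemma 2.6]
[cite: GrossLMS1991, §8 (proof of Prop. 8.1)] [cite: DarmonDiamondTaylor1995, Prop. 2.8 (a)] [cite: Serre1981, §8.1
eq. (238)] [cite: NeukirchANT1999, Ch. I §9 (9.4)–(9.5)].
-/

-- single-conjunct summit: `Summit.BirchSwinnertonDyer.BirchSwinnertonDyer.…` repeats the name by design
set_option linter.dupNamespace false

noncomputable section

open scoped Classical Pointwise
open Polynomial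

namespace Summit.BirchSwinnertonDyer.BirchSwinnertonDyer.Theorems.AdditiveKoly

open WeierstrassCurve NumberField IsDedekindDomain Field Rat.HeightOneSpectrum
open Literature.NumberTheory.EllipticCurves Literature.NumberTheory.GaloisRepresentations Module
open Summit.BirchSwinnertonDyer.Rank1Residual.X11b.Three.Koly.Method2

/-! ## §1 The sign of a Bertolini–Darmon admissible prime on `E(ℚ̄)[p]` -/

section Plane

variable {k : Type*} [Field k] {V : Type*} [AddCommGroup V] [Module k V]

/-- On a `2`-dimensional space the characteristic polynomial of an endomorphism `f` is `X² − tr(f) X + det(f)`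
(Mathlib `Matrix.charpoly_fin_two` in a basis; a copy of koly g13's private lemma). [folklore] -/
private theorem charpoly_eq_of_finrank_eq_two' [FiniteDimensional k V] (h2 : Module.finrank k V = 2)
    (f : Module.End k V) :
    f.charpoly = X ^ 2 - C (LinearMap.trace k V f) * X + C (LinearMap.det f) := by
  let b := Module.finBasisOfFinrankEq k V h2
  rw [← LinearMap.charpoly_toMatrix f b, Matrix.charpoly_fin_two,
    ← LinearMap.trace_eq_matrix_trace k b f, LinearMap.det_toMatrix b f]

/-- Cayley–Hamilton in dimension `2`, pointwise: `f (f x) = tr(f) • f x - det(f) • x`. [folklore] -/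
private theorem apply_apply_eq_of_finrank_eq_two' [FiniteDimensional k V] (h2 : Module.finrank k V = 2)
    (f : Module.End k V) (x : V) :
    f (f x) = LinearMap.trace k V f • f x - LinearMap.det f • x := by
  have hCH := LinearMap.aeval_self_charpoly f
  rw [charpoly_eq_of_finrank_eq_two' h2, map_add, map_sub, map_mul, aeval_C, aeval_C, map_pow, aeval_X] at hCH
  have h := congrArg (fun g : Module.End k V => g x) hCH
  simp only [LinearMap.add_apply, LinearMap.sub_apply, LinearMap.zero_apply, Module.End.mul_apply,
    pow_two, Module.algebraMap_end_apply] at h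
  rw [sub_add_eq_add_sub, sub_eq_zero] at h
  rw [eq_sub_iff_add_eq]
  rw [← h]

/-- **`f ≡ ε` modulo `(f² − 1)`** for `f` with `f² = ε(q+1) f − q`, `ε² = 1`: explicitly
`(f² − 1)((q² − 1)⁻¹ (f y − ε y)) = f y − ε y`, because `(f² − 1)(f − ε) y = (q² − 1)(f − ε) y`. [folklore] -/
private theorem sq_sub_one_apply_sub_eq (f : Module.End k V) {ε qq : k} (hε : ε = 1 ∨ ε = -1)
    (hCH : ∀ Q, f (f Q) = (ε * (qq + 1)) • f Q - qq • Q) (y : V) :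
    f (f (f y - ε • y)) - (f y - ε • y) = (qq * qq - 1) • (f y - ε • y) := by
  have h1 : f (f (f y - ε • y)) = (ε * (qq + 1)) • f (f y) - qq • f y - ε • f (f y) := by
    rw [map_sub, map_smul, map_sub, map_smul, hCH (f y)]
  rw [h1, hCH y]
  rcases hε with rfl | rfl <;> module

/-- **`f = εq` on the `q²`-eigenspace of `f²`** for `f` with `f² = ε(q+1) f − q`, `ε² = 1`, `q ≢ −1`. [folklore] -/
private theorem apply_eq_of_sq_apply_eq (f : Module.End k V) {ε qq : k} (hε : ε = 1 ∨ ε = -1) (hq1 : qq + 1 ≠ 0)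
    (hCH : ∀ Q, f (f Q) = (ε * (qq + 1)) • f Q - qq • Q) {y : V} (hy : f (f y) = (qq * qq) • y) :
    f y = (ε * qq) • y := by
  have hεε : ε * ε = 1 := by rcases hε with rfl | rfl <;> ring
  have h1 : (qq + 1) • (f y - (ε * qq) • y) = 0 := by
    have h := hCH y
    rw [hy] at h
    -- `(q+1) • f y = ε • (ε(q+1) • f y) = ε • (q² • y + q • y)`
    have h2 : (ε * (qq + 1)) • f y = (qq * qq) • y + qq • y := by rw [h]; module
    have h3 : (qq + 1) • f y = ε • ((ε * (qq + 1)) • f y) := by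
      rw [smul_smul, ← mul_assoc, hεε, one_mul]
    rw [smul_sub, h3, h2]
    rcases hε with rfl | rfl <;> module
  rcases smul_eq_zero.mp h1 with h | h
  · exact absurd h hq1
  · exact sub_eq_zero.mp h

end Plane

section Sign

variable (W : WeierstrassCurve ℚ) [W.IsElliptic] [W.IsGloballyMinimal]

/-- **The sign of a Bertolini–Darmon admissible prime on `E(ℚ̄)[p]`: `ρ̄(Frob_q) ∼ diag(ε, εq)`.** Let `p` be a prime,
`q` BD `1`-admissible for `(E, K, p)` (`q ∤ pN_E`, `p ∤ q² − 1`, `p ∣ q + 1 − a_q` or `p ∣ q + 1 + a_q`), `h ∈ Γ_ℚ` an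
arithmetic Frobenius at a prime of `\bar ℤ` above `q`. Then there is `ε = ±1` with (i) `h y − ε y ∈ (h² − 1)E[p]` for
every `y ∈ E(ℚ̄)[p]`, and (ii) `h y = εq · y` whenever `h² y = q² y`. (`tr ρ̄(h) = a_q ≡ ε(q+1)`, `det ρ̄(h) = q` on the
`𝔽_p`-plane `E[p]`; Cayley–Hamilton.) [cite: WZhang2014, Notations (xiv), §9 (9.2)] [cite: BertoliniDarmon2005, p. 18]
[cite: DarmonDiamondTaylor1995, Prop. 2.8 (a)] [cite: Serre1981, §8.1 eq. (238)] -/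
theorem exists_sign_of_isAdmissiblePrime {p : ℕ} [Fact p.Prime]
    {K : Type} [Field K] [NumberField K] {q : ℕ}
    (hq : BertoliniDarmon2005.IsAdmissiblePrime (W.conductorNorm ℤ) K (fun ℓ ↦ W.frobeniusTrace ℓ) p 1 q)
    {w : HeightOneSpectrum (𝓞 ℚ)} (hqw : (q : 𝓞 ℚ) ∈ w.asIdeal)
    {𝔓 : Ideal (absIntegers (𝓞 ℚ) ℚ)} (h𝔓 : 𝔓 ∈ w.primesAbove)
    {h : absoluteGaloisGroup ℚ} (hh : IsArithFrobAt (𝓞 ℚ) h 𝔓) :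
    ∃ ε : ℤ, (ε = 1 ∨ ε = -1) ∧
      (∀ y : geomTorsion W (p : ℤ), ∃ m : geomTorsion W (p : ℤ), h • y - ε • y = h • h • m - m) ∧
      ∀ y : geomTorsion W (p : ℤ), h • h • y = ((q : ℤ) ^ 2) • y → h • y = (ε * q) • y := by
  have hp : p.Prime := Fact.out
  obtain ⟨hqprime, hqpN, -, hsq, hcong⟩ := hq
  haveI : Fact q.Prime := ⟨hqprime⟩
  have hqN : ¬ q ∣ W.conductorNorm ℤ := fun h' ↦ hqpN (Dvd.dvd.mul_left h' p)
  have hqp : q ≠ p := by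
    rintro rfl
    exact hqpN (dvd_mul_right q _)
  -- good reduction at `q`, `primesEquiv w = q`
  have hvq : (primesEquiv w : ℕ) = q := primesEquiv_eq_of_natCast_mem hqprime hqw
  have hgood : W.HasGoodReductionAtPrime q :=
    (hasGoodReductionAtPrime_primesEquiv_iff_holds W w q hvq).mpr
      (LocalFrob.hasGoodReductionAt_rat_of_not_dvd_conductorNorm W hqprime hqN w hqw)
  -- the linear map of `h` on the `𝔽_p`-plane `E[p]`
  letI : Module (ZMod p) (geomTorsion W (p : ℤ)) := AddSubgroup.torsionBy.zmodModule
  set f := (galoisRepTorsion W p h).toAdd.toAddMonoidHom.toZModLinearMap p with hfdef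
  have hf : ∀ Q : geomTorsion W (p : ℤ), f Q = h • Q := fun Q => rfl
  have htr : LinearMap.trace (ZMod p) _ f = (W.frobeniusTrace q : ZMod p) :=
    W.trace_galoisRepTorsion_frobenius_eq p hqp hgood hvq h𝔓 hh
  have hdet : LinearMap.det f = (q : ZMod p) := W.det_galoisRepTorsion_frobenius_eq p hqp hgood hvq h𝔓 hh
  have h2 : Module.finrank (ZMod p) (geomTorsion W (p : ℤ)) = 2 :=
    Literature.RepresentationTheory.FiniteGroups.Representation.finrank_eq_two_of_natCard_eq_sq
      (card_torsionPoints_eq_sq_holds W (AlgebraicClosure ℚ) (n := p) (by exact_mod_cast hp.ne_zero))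
  haveI : FiniteDimensional (ZMod p) (geomTorsion W (p : ℤ)) := Module.finite_of_finrank_eq_succ h2
  -- `q² ≠ 1` in `𝔽_p`, hence `q + 1 ≠ 0`
  have hq2 : (q : ZMod p) * (q : ZMod p) ≠ 1 := by
    intro h1
    apply hsq
    have h1' : (((q : ℤ) ^ 2 - 1 : ℤ) : ZMod p) = 0 := by push_cast; rw [pow_two, h1, sub_self]
    exact (ZMod.intCast_zmod_eq_zero_iff_dvd _ p).mp h1'
  have hq1 : (q : ZMod p) + 1 ≠ 0 := by
    intro h0
    apply hq2
    have : (q : ZMod p) = -1 := by linear_combination h0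
    rw [this]; ring
  -- the sign from the admissibility congruence: `a_q = ε (q + 1)` in `𝔽_p`
  obtain ⟨ε, hε, haε⟩ : ∃ ε : ℤ, (ε = 1 ∨ ε = -1) ∧
      (W.frobeniusTrace q : ZMod p) = (ε : ZMod p) * ((q : ZMod p) + 1) := by
    rcases hcong with hc | hc
    · refine ⟨1, Or.inl rfl, ?_⟩
      rw [pow_one] at hc
      have h0 : (((q : ℤ) + 1 - W.frobeniusTrace q : ℤ) : ZMod p) = 0 :=
        (ZMod.intCast_zmod_eq_zero_iff_dvd _ p).mpr hc
      push_cast at h0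
      rw [Int.cast_one, one_mul]
      linear_combination -h0
    · refine ⟨-1, Or.inr rfl, ?_⟩
      rw [pow_one] at hc
      have h0 : (((q : ℤ) + 1 + W.frobeniusTrace q : ℤ) : ZMod p) = 0 :=
        (ZMod.intCast_zmod_eq_zero_iff_dvd _ p).mpr hc
      push_cast at h0
      rw [Int.cast_neg, Int.cast_one]
      linear_combination h0
  have hεk : (ε : ZMod p) = 1 ∨ (ε : ZMod p) = -1 := by
    rcases hε with rfl | rfl
    · exact Or.inl (by push_cast; rfl)
    · exact Or.inr (by push_cast; rfl)
  -- Cayley–Hamilton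
  have hCH : ∀ Q, f (f Q) = ((ε : ZMod p) * ((q : ZMod p) + 1)) • f Q - (q : ZMod p) • Q := fun Q ↦ by
    rw [apply_apply_eq_of_finrank_eq_two' h2 f Q, htr, hdet, haε]
  -- `(q² − 1)⁻¹`
  set u : ZMod p := ((q : ZMod p) * (q : ZMod p) - 1)⁻¹ with hu
  have huq : u * ((q : ZMod p) * (q : ZMod p) - 1) = 1 := inv_mul_cancel₀ (sub_ne_zero.mpr hq2)
  refine ⟨ε, hε, fun y ↦ ?_, fun y hy ↦ ?_⟩
  · -- (i) `h y − ε y = (h² − 1) m` with `m = u • (h y − ε y)`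
    set m : geomTorsion W (p : ℤ) := u • (f y - (ε : ZMod p) • y) with hm
    refine ⟨m, ?_⟩
    have hgoal : f (f m) - m = f y - (ε : ZMod p) • y := by
      rw [hm, map_smul, map_smul, ← smul_sub, sq_sub_one_apply_sub_eq f hεk hCH y, smul_smul, huq, one_smul]
    rw [hf (f m), hf m, hf y, Int.cast_smul_eq_zsmul] at hgoal
    exact hgoal.symm
  · -- (ii) `h y = εq y` on the `q²`-eigenspace of `h²`
    have hy' : f (f y) = ((q : ZMod p) * (q : ZMod p)) • y := by
      rw [hf, hf, hy, ← Int.cast_smul_eq_zsmul (ZMod p) ((q : ℤ) ^ 2) y]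
      push_cast
      rw [pow_two]
    rw [← hf, apply_eq_of_sq_apply_eq f hεk hq1 hCH hy', ← Int.cast_smul_eq_zsmul (ZMod p) (ε * q) y]
    push_cast
    rfl

end Sign

/-! ## §2 The Frobenius lift of complex conjugation at the place above a BD-admissible prime -/

section Lift

variable (W : WeierstrassCurve ℚ) [W.IsElliptic] [W.IsGloballyMinimal] (K : Type) [Field K] [NumberField K]

/-- **The Frobenius lift of complex conjugation at `v ∣ q`** (`q` BD-admissible, `[K : ℚ] = 2`, `c ≠ 1`). There are an
arithmetic Frobenius `h ∈ Γ_ℚ` at the prime of `\bar ℤ` below `𝔓 = 𝔓_{ι₀,𝔐}`, an arithmetic Frobenius `F ∈ Γ_K` at `𝔓`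
with `res F = h²`, and a sign `ε = ±1`, such that the transport `t = e h e⁻¹` LIFTS `c` (`h ∉ res Γ_K` since
`f(v|q) = 2`), `t⁻¹ F t = F`, and `t` acts on `E(K̄)[p]` (`IsLiftOfAut.torsionMap`) as `ε` modulo `(F − 1)E(K̄)[p]`
(the toric line) and as `εq` on the `q²`-eigenspace of `F` (§1 transported along `E(ℚ̄)[p] ≃ E(K̄)[p]`). Port of
zhang3-p1's `exists_lift_frob_of_uAdmissible`; the `p`-generic analogue of the tree's
`exists_frobeniusLift_of_isKolyvaginPrime` (Gross §8) at an ADMISSIBLE (rather than Kolyvagin) prime.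
[cite: WZhang2014, §9 (9.2), Notations (xiv)] [cite: GrossLMS1991, §8 (proof of Prop. 8.1)]
[cite: NeukirchANT1999, Ch. I §9 (9.4)–(9.5)] -/
theorem exists_lift_frob_of_isAdmissiblePrime (hK2 : Module.finrank ℚ K = 2) {c : K ≃ₐ[ℚ] K} (hc1 : c ≠ 1)
    {p : ℕ} [Fact p.Prime] {q : ℕ}
    (hq : BertoliniDarmon2005.IsAdmissiblePrime (W.conductorNorm ℤ) K (fun ℓ ↦ W.frobeniusTrace ℓ) p 1 q)
    (v : HeightOneSpectrum (𝓞 K)) (hqv : (q : 𝓞 K) ∈ v.asIdeal)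
    {𝔐 : Ideal (HeightOneSpectrum.localAbsIntegers v)} (h𝔐 : 𝔐 ∈ v.localPrimesAbove) :
    ∃ (h : absoluteGaloisGroup ℚ) (F : absoluteGaloisGroup K)
      (ht : IsLiftOfAut c (absGaloisTransport (K := ℚ) (L := K) h).toRingEquiv) (ε : ℤ),
      IsArithFrobAt (𝓞 ℚ) h ((v.primeBelow (closureEmb (K := K) (v.adicCompletion K)) 𝔐).comap (absIntegersMap ℚ K)) ∧
      IsArithFrobAt (𝓞 K) F (v.primeBelow (closureEmb (K := K) (v.adicCompletion K)) 𝔐) ∧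
      absGaloisRestrict ℚ K F = h ^ 2 ∧ ht.conjGalCMH F = F ∧ (ε = 1 ∨ ε = -1) ∧
      (∀ y : geomTorsion (W.baseChange K) (p : ℤ), ∃ m : geomTorsion (W.baseChange K) (p : ℤ),
        ht.torsionMap W (p : ℤ) y - ε • y = F • m - m) ∧
      ∀ y : geomTorsion (W.baseChange K) (p : ℤ), F • y = ((q : ℤ) ^ 2) • y →
        ht.torsionMap W (p : ℤ) y = (ε * q) • y := by
  haveI : Algebra.IsQuadraticExtension ℚ K := ⟨hK2⟩
  have hq' := hq
  obtain ⟨hqprime, -, hinert, -, -⟩ := hq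
  set ι₀ := closureEmb (K := K) (v.adicCompletion K) with hι₀
  set 𝔓 := v.primeBelow ι₀ 𝔐 with h𝔓def
  have h𝔓 : 𝔓 ∈ v.primesAbove := HeightOneSpectrum.primeBelow_mem_primesAbove h𝔐
  set w : HeightOneSpectrum (𝓞 ℚ) := v.under (𝓞 ℚ) with hw
  have hwv : v.asIdeal.under (𝓞 ℚ) = w.asIdeal := rfl
  have hqw : (q : 𝓞 ℚ) ∈ w.asIdeal := by
    rw [← hwv, Ideal.under_def, Ideal.mem_comap, map_natCast]; exact hqv
  set 𝔓' := 𝔓.comap (absIntegersMap ℚ K) with h𝔓'def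
  have h𝔓' : 𝔓' ∈ w.primesAbove := comap_absIntegersMap_mem_primesAbove hwv h𝔓
  haveI := h𝔓'.1
  -- an arithmetic Frobenius `h ∈ Γ_ℚ` at `𝔓'` and its sign on `E(ℚ̄)[p]`
  obtain ⟨h, hFrob⟩ := HeightOneSpectrum.exists_isArithFrobAt_of_mem_primesAbove_holds h𝔓'
  obtain ⟨ε, hε, hquot, hker⟩ := exists_sign_of_isAdmissiblePrime W hq' hqw h𝔓' hFrob
  -- `F` with `res F = h²`, an arithmetic Frobenius at `𝔓` (`f(v|q) = 2`)
  obtain ⟨F, hF⟩ := LocalFrob.sq_mem_range_absGaloisRestrict K hK2 h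
  have hf2 := LocalFrob.inertiaDeg_eq_two_of_isPrime_span K hK2 hqprime hinert v hqv
  have hFrobF : IsArithFrobAt (𝓞 K) F 𝔓 :=
    isArithFrobAt_of_absGaloisRestrict_eq_pow (F := ℚ) (M := K) hwv h𝔓 hFrob (by rw [hF, hf2])
  -- the transport `t = e h e⁻¹` lifts `c`
  set tA := absGaloisTransport (K := ℚ) (L := K) h with htA
  have hne1 : tA.restrictNormal K ≠ 1 := by
    intro h1
    have hmem : h ∈ Set.range (absGaloisRestrict ℚ K) := by
      rw [mem_range_absGaloisRestrict_iff]
      intro x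
      have hx := AlgEquiv.restrictNormal_commutes tA K x
      rw [h1, AlgEquiv.one_apply] at hx
      exact hx.symm
    obtain ⟨τ, hτ⟩ := hmem
    have hf1 := inertiaDeg_eq_one_of_isArithFrobAt_absGaloisRestrict (F := ℚ) (M := K) hwv h𝔓 (τ := τ)
      (by rw [hτ]; exact hFrob)
    rw [hf2] at hf1
    exact absurd hf1 (by norm_num)
  have ht : IsLiftOfAut c tA.toRingEquiv := by
    have hcard : Nat.card (K ≃ₐ[ℚ] K) = 2 := by rw [IsGalois.card_aut_eq_finrank, hK2]
    obtain ⟨y, -, hy⟩ := (Nat.card_eq_two_iff' (1 : K ≃ₐ[ℚ] K)).mp hcard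
    rw [hy c hc1, ← hy _ hne1]
    exact RatClosure.isLiftOfAut_restrictNormal_absGaloisTransport h
  -- `t² = F` on `K̄`, hence `t⁻¹ F t = F`
  have hFt : ∀ y : AlgebraicClosure K, F • y = tA (tA y) := fun y ↦ by
    rw [← absGaloisTransport_absGaloisRestrict (K := ℚ) F y, hF, pow_two, map_mul, AlgEquiv.mul_apply]
  have hcF : ht.conjGalCMH F = F := by
    apply AlgEquiv.ext
    intro x
    change tA.toRingEquiv.symm ((show AlgebraicClosure K ≃ₐ[K] AlgebraicClosure K from F)
      (tA.toRingEquiv x)) = (show AlgebraicClosure K ≃ₐ[K] AlgebraicClosure K from F) x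
    rw [RingEquiv.symm_apply_eq]
    change F • tA x = tA (F • x)
    rw [hFt, hFt]
  -- transport of `h`, `h²` along `θ : E(ℚ̄)[p] ≃ E(K̄)[p]`
  set θ := RatClosure.torsionEquiv (K := K) W (p : ℤ) with hθ
  have hFθ : ∀ P : geomTorsion W (p : ℤ), F • θ P = θ (h • h • P) := fun P ↦ by
    rw [← RatClosure.torsionEquiv_smul, hF, pow_two, mul_smul]
  have htθ : ∀ P : geomTorsion W (p : ℤ), ht.torsionMap W (p : ℤ) (θ P) = θ (h • P) :=
    fun P ↦ (RatClosure.torsionEquiv_smul_of_lift W ht h (fun _ ↦ rfl) _ P).symm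
  refine ⟨h, F, ht, ε, hFrob, hFrobF, hF, hcF, hε, fun y ↦ ?_, fun y hy ↦ ?_⟩
  · obtain ⟨P, rfl⟩ := θ.surjective y
    obtain ⟨m, hm⟩ := hquot P
    refine ⟨θ m, ?_⟩
    rw [htθ, hFθ, ← map_zsmul, ← map_sub, ← map_sub, hm]
  · obtain ⟨P, rfl⟩ := θ.surjective y
    rw [hFθ, ← map_zsmul] at hy
    rw [htθ, ← map_zsmul, hker P (θ.injective hy)]

end Lift

end Summit.BirchSwinnertonDyer.BirchSwinnertonDyer.Theorems.AdditiveKoly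

end
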